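import Summits.BirchSwinnertonDyer.BirchSwinnertonDyer.Theorems.SmallImageMuTransferMuTransferX9LocalExponentBadPrimes
import Summits.BirchSwinnertonDyer.BirchSwinnertonDyer.Theorems.SmallImageMuTransferMuTransferX9LocalTowerUnramified
import Literature.NumberTheory.EllipticCurves.IwasawaTwistModPTower
import Literature.NumberTheory.EllipticCurves.KummerSelmerStructure
import Literature.NumberTheory.GaloisRepresentations.CyclotomicTowerLocalIndex
import HarnessLib

/-!
# K6 crux `MuTransferX9` (stmt-BirchSwinnertonDyer-19276), skeleton v5, G1-LOCAL input (file 2 of 2):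
# the UNIFORM LOCAL EXPONENT — `T_v^[2d·p^m]` kills `H¹(K_v, 𝒯_J)` for EVERY level `J` (`v ∤ p`)

Cell `bsd-smallim`, seat `bsd-smallim-k6-g4` gen 0 (route `SmallImageMuTransfer`, rung K6, leaf
`Rank1Residual.BSDpOnClassX9`), brief HOME/plan/k6/briefs/BRIEF-k6-g4-G1-local-exponent.md (plan g8).
HONEST FRAMING: TOOL theorems; no definition, no named fact, no `sorry`; nothing is asserted about any
curve and nothing is booked; class X9 stays TYPED at class level. Serves the OPEN registered stub
`stub_coreX9` of crux 19276 as the "uniform local exponent at the bad primes" input of k6-c2 g3's G1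
design note — support UNDER k6-c2's G1, no claim on the stub — and credits nothing toward the crux
(`--supports … --as helper`).  PARTITION (D-0054): X9 (A4) × p ∈ {5, 7} (prime- and field-generic,
so also X10b ∧ ¬Surj at 3 and the dual twist `κ⁻¹`) — helper; closes NONE.

## Content (sequel of `…X9LocalExponentBadPrimes.lean`, which bounds `#H¹(K_v, 𝒯_J) ≤ #M^{2·p^m}`)

* §4 `localShift_iterate_eq_zero_of_le` — the local shift `T_v = H¹(K_v, S)` (k6-ty's `twistModPShift`
  restricted to `Γ_{K_v}`, on `galoisCohomology (GaloisRep.toLocal v (κ.twistModP ρ J)) 1`) is nilpotent,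
  `T_v^[J] = 0`; **`localShift_iterate_eq_zero_of_depth`** (HEADLINE): for `v ∤ p`, `#M = p^d` and
  `g ∈ Γ_{K_v}` with `ρ(res g) = 1`, fixing `μ_p`, of depth `m`: **`T_v^[2·d·p^m] c = 0` for every `J`
  and every `c ∈ H¹(K_v, 𝒯_J)`** (file 1 §3 + Cayley–Hamilton, file 1 §0); global form
  `localization_shiftH1_iterate_eq_zero_of_depth`: `loc_v (T^[2d·p^m] y) = 0` for global `y`
  (k6-ty's `shiftH1`; `loc_v` commutes with the shift, tree `galoisCohomology.res_map_one`).
  For `M = E[p]` (`d = 2`): `ε_v = 4·p^m`, the brief's `4·p^{s_v}` at depth `m = s_v`.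
* §5 `exists_trivial_depth_of_apply_ne_one` — the auxiliary `g` exists as soon as `κ` is non-trivial
  on `Γ_{K_v}`: for ANY `τ` with `κ(res τ) ≠ 1`, `g = τ^{N₁N₂}` (`N₁ = ord ρ(res τ)` in `Aut M`, `N₂` =
  the order of `τ` on `μ_p(K̄_v)`) is `ρ`-trivial, fixes `μ_p`, and has finite depth (the `p`-adic
  valuation of `κ(res g) = κ(res τ)^{N₁N₂} ≠ 1`; `ℤ_p` is torsion-free).
* §6 `exists_uniform_localShift_iterate_eq_zero` / `exists_uniform_localization_shiftH1_iterate_eq_zero`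
  — packaging: `∃ ε_v, ∀ ε ≥ ε_v, ∀ J, ∀ c, T_v^[ε] c = 0` (resp. `loc_v (T^[ε] y) = 0`).
* §7 the CYCLOTOMIC `ℤ_p`-extension (`κ.IsCyclotomic`): `κ` is non-trivial on every decomposition group
  (tree `exists_apply_resGal_ne_one_of_isCyclotomic'`, Greenberg LNM 1716 §1), so the hypothesis of §§5–6
  is discharged: `exists_uniform_localization_shiftH1_iterate_eq_zero_of_isCyclotomic` (one `v ∤ p`) and
  **`exists_uniform_localization_shiftH1_iterate_eq_zero_finset_of_isCyclotomic`** — ONE `ε` for a finite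
  set `S` of places `v ∤ p`, all `ε' ≥ ε`, all `J`, all global `y`: the `v ∈ S ∖ {p}` clause of the G1
  stub `stub_selmerDualOdd` of skeleton v6 (with `κ ↦ κ.invTwist`, `ρ = E[p]`, `J ↦ J + 1`), for which
  `κ.invTwist.IsCyclotomic`-vs-`κ.IsCyclotomic` is immaterial: use §6 with the witness of
  `exists_apply_resGal_ne_one_of_isCyclotomic'` for `κ` (`κ⁻¹(res τ) ≠ 1 ↔ κ(res τ) ≠ 1`).
Not here (other hands): the G1 map itself and the place `v = p` (k6-c2 g3); the unramified clause at
`v ∉ S ∪ {p}` (koly's `…X9LocalTowerUnramified`); the reciprocity step (x10 g38); the `q`-term (koly g8).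

References: HOME/koly/MU-TRANSFER-PROOF.md (F6), §5 STEP 1; J. S. Milne, *Arithmetic Duality
Theorems* (2006) I Thm. 2.8 [MilneADT2006]; J.-P. Serre, *Galois Cohomology* (1997) I §2 [SerreGaloisCohomology1997];
B. Mazur, K. Rubin, Mem. AMS 799 (2004) Lemma 5.3.1 [MazurRubin2004]; L. Washington, *Introduction to
Cyclotomic Fields* §13 [Washington1997].
-/

set_option linter.dupNamespace false
set_option autoImplicit false

noncomputable section

open scoped Classical ContRepresentation

universe u

namespace Summit.BirchSwinnertonDyer.BirchSwinnertonDyer.Rank1Residual.LocalSplitPrime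


open CategoryTheory ContinuousCohomology Function Field ValuativeRel NumberField IsDedekindDomain
open Literature.NumberTheory.GaloisRepresentations
open Literature.NumberTheory.GaloisRepresentations.IsNonarchimedeanLocalField
open _root_.TopRep
open Literature.NumberTheory.GaloisCohomology
open Literature.NumberTheory.EllipticCurves


/-! ## §4 The uniform local exponent: `T^{2d·p^m}` kills `H¹(K_v, 𝒯_J)` for every `J` -/

section Exponent

variable {K : Type u} [Field K] [NumberField K] {M : Type u} [AddCommGroup M] [TopologicalSpace M]
  [DiscreteTopology M] [Finite M] (ρ : DiscreteGaloisModule K M) {p : ℕ} [Fact p.Prime]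
  (hM : ∀ x : M, p • x = 0) (κ : ZpExtension K p) (J : ℕ) (v : HeightOneSpectrum (𝓞 K))

omit [Finite M] in
/-- The local shift `T_v = H¹(K_v, S)` on `H¹(K_v, 𝒯_J)` is nilpotent: `T_v^[k] [φ] = [S^k ∘ φ]`, hence
`T_v^[J] = 0` (`S^J = 0` on `𝒯_J`; local form of k6-ty's `shiftH1_iterate_eq_zero`).
[cite: Washington1997, §13.1–§13.2] [cite: SerreGaloisCohomology1997, I §2.2] -/
theorem localShift_iterate_eq_zero_of_le {k : ℕ} (hk : J ≤ k)
    (c : galoisCohomology (GaloisRep.toLocal v (κ.twistModP ρ hM J)) 1) :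
    (galoisCohomology.map ((κ.twistModPShift ρ hM J).restrictField (v.adicCompletion K)) 1)^[k] c = 0 := by
  -- `T_v^[k] [φ] = [ψ]` with `ψ = S^k ∘ φ`
  have hiter : ∀ (k : ℕ) (φ : contOneCocycles (GaloisRep.toLocal v (κ.twistModP ρ hM J)).toTopRep),
      ∃ ψ : contOneCocycles (GaloisRep.toLocal v (κ.twistModP ρ hM J)).toTopRep,
      (∀ x, ψ.1 x = (shiftEnd M J ^ k) (φ.1 x)) ∧
        (galoisCohomology.map ((κ.twistModPShift ρ hM J).restrictField (v.adicCompletion K)) 1)^[k]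
          (oneCocycleClass _ φ) = oneCocycleClass _ ψ := by
    intro k
    induction k with
    | zero => exact fun φ => ⟨φ, fun x => by simp, rfl⟩
    | succ k ih =>
      intro φ
      obtain ⟨ψ, hψ, hk⟩ := ih φ
      obtain ⟨ψ', hψ', hmap⟩ := galoisCohomology_map_oneCocycleClass _ _
        ((κ.twistModPShift ρ hM J).restrictField (v.adicCompletion K)) ψ
      refine ⟨ψ', fun x => ?_, ?_⟩
      · rw [hψ', pow_succ', Module.End.mul_apply, ← hψ]
        rfl
      · rw [Function.iterate_succ_apply', hk]
        exact hmap
  obtain ⟨φ, rfl⟩ := oneCocycleClass_surjective _ c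
  obtain ⟨ψ, hψ, hψk⟩ := hiter k φ
  refine hψk.trans ((oneCocycleClass_eq_zero_iff _ ψ).2 ⟨0, fun x => ?_⟩)
  rw [hψ, shiftEnd_pow_eq_zero hk, LinearMap.zero_apply, map_zero, sub_zero]

/-- **THE UNIFORM LOCAL EXPONENT (headline; G1-LOCAL input of crux 19276, skeleton v5).**  Let `v ∤ p`
be a finite place of `K`, `#M = p^d`, and `g ∈ Γ_{K_v}` an element with `ρ(res g) = 1`, fixing the
`p`-th roots of unity, of depth `m` in the `ℤ_p`-tower of `κ`.  Then for EVERY level `J` and every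
class `c ∈ H¹(K_v, 𝒯_J)`:

  `T_v^[2·d·p^m] c = 0`,  `T_v = H¹(K_v, S)` the shift on the local cohomology of the twist.

(`H¹(K_v, 𝒯_J)` is an `𝔽_p`-vector space of dimension `≤ 2d·p^m` by §3, on which `T_v` is nilpotent.)
For `M = E[p]` (`d = 2`) this is the exponent `ε_v = 4·p^m`, independent of `J`, of the G1 design note
("at `v ∈ S ∖ {p}` the whole `H¹(ℚ_v, 𝒯_J)` has order `≤ p^{4·p^{s_v}}`, uniformly in `J`, hence
`T^{ε_v} · H¹(ℚ_v, 𝒯_J) = 0`"; MU-TRANSFER-PROOF §5 STEP 1 "`T^ε · loc_v y = 0`", (F6)).  The same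
statement applies verbatim to the dual twist `κ⁻¹.twistModP ρ′ J` (`κ.invTwist` is a `ℤ_p`-extension
with the same layers, `ZpExtension.layerSubgroup_invTwist`).
[cite: MilneADT2006, Ch. I §2, Thm. 2.8 (p. 31)] [cite: MazurRubin2004, Lemma 5.3.1] -/
theorem localShift_iterate_eq_zero_of_depth (hpv : (p : 𝓞 K) ∉ v.asIdeal) {d : ℕ}
    (hcard : Nat.card M = p ^ d)
    {g : absoluteGaloisGroup (v.adicCompletion K)}
    (hg : ρ (absGaloisRestrict K (v.adicCompletion K) g) = 1)
    (hμ : ∀ ζ : (AlgebraicClosure (v.adicCompletion K))ˣ, ζ ^ p = 1 → g • ζ = ζ) {m : ℕ}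
    (hgm : absGaloisRestrict K (v.adicCompletion K) g ∈ κ.layerSubgroup m)
    (hgm' : absGaloisRestrict K (v.adicCompletion K) g ∉ κ.layerSubgroup (m + 1))
    (c : galoisCohomology (GaloisRep.toLocal v (κ.twistModP ρ hM J)) 1) :
    (galoisCohomology.map ((κ.twistModPShift ρ hM J).restrictField (v.adicCompletion K)) 1)^[2 * d * p ^ m]
      c = 0 := by
  haveI : CharZero (v.adicCompletion K) := charZero_adicCompletion v
  haveI : Finite (galoisCohomology (GaloisRep.toLocal v (κ.twistModP ρ hM J)) 1) :=
    finite_galoisCohomology_one_of_isNonarchimedeanLocalField _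
  have hMJ : ∀ x : Fin J → M, p • x = 0 := fun x => funext fun i => hM (x i)
  refine iterate_eq_zero_of_nilpotent_of_natCard_le
    (galoisCohomology.nsmul_eq_zero_of_forall (GaloisRep.toLocal v (κ.twistModP ρ hM J)) hMJ) _
    (localShift_iterate_eq_zero_of_le ρ hM κ J v le_rfl) ?_ c
  calc Nat.card (galoisCohomology (GaloisRep.toLocal v (κ.twistModP ρ hM J)) 1)
      ≤ Nat.card M ^ (2 * p ^ m) :=
        natCard_galoisCohomology_one_toLocal_twistModP_le_of_depth ρ hM κ J v hpv hg hμ hgm hgm'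
    _ = p ^ (2 * d * p ^ m) := by rw [hcard, ← pow_mul]; ring_nf

/-- **Global form**: for a GLOBAL class `y ∈ H¹(K, 𝒯_J)`, the localisation at `v` of `T^[2·d·p^m] y`
(k6-ty's `shiftH1`) vanishes — `loc_v` commutes with the shift (`galoisCohomology.res_map_one`).  This is
the shape "`T^[ε]·loc_v ψ = 0` on `S ∖ {p}`" consumed by the G1 map of crux 19276.
[cite: MilneADT2006, Ch. I §2, Thm. 2.8 (p. 31)] [cite: SerreGaloisCohomology1997, I §2.4] -/
theorem localization_shiftH1_iterate_eq_zero_of_depth (hpv : (p : 𝓞 K) ∉ v.asIdeal) {d : ℕ}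
    (hcard : Nat.card M = p ^ d)
    {g : absoluteGaloisGroup (v.adicCompletion K)}
    (hg : ρ (absGaloisRestrict K (v.adicCompletion K) g) = 1)
    (hμ : ∀ ζ : (AlgebraicClosure (v.adicCompletion K))ˣ, ζ ^ p = 1 → g • ζ = ζ) {m : ℕ}
    (hgm : absGaloisRestrict K (v.adicCompletion K) g ∈ κ.layerSubgroup m)
    (hgm' : absGaloisRestrict K (v.adicCompletion K) g ∉ κ.layerSubgroup (m + 1))
    (y : galoisCohomology (κ.twistModP ρ hM J) 1) :
    galoisCohomology.localization (κ.twistModP ρ hM J) (Sum.inr v) 1 ((κ.shiftH1 ρ hM J)^[2 * d * p ^ m] y)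
      = 0 := by
  -- localisation commutes with the shift
  have hcomm : ∀ (k : ℕ) (z : galoisCohomology (κ.twistModP ρ hM J) 1),
      galoisCohomology.localization (κ.twistModP ρ hM J) (Sum.inr v) 1 ((κ.shiftH1 ρ hM J)^[k] z) =
        (galoisCohomology.map ((κ.twistModPShift ρ hM J).restrictField (v.adicCompletion K)) 1)^[k]
          (galoisCohomology.localization (κ.twistModP ρ hM J) (Sum.inr v) 1 z) := by
    intro k
    induction k with
    | zero => intro z; rfl
    | succ k ih =>
      intro z
      rw [Function.iterate_succ_apply', Function.iterate_succ_apply', ← ih]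
      exact galoisCohomology.res_map_one (v.adicCompletion K) (κ.twistModPShift ρ hM J) _
  rw [hcomm]
  exact localShift_iterate_eq_zero_of_depth ρ hM κ J v hpv hcard hg hμ hgm hgm' _

end Exponent

/-! ## §5 Existence of the auxiliary element: any `τ ∈ Γ_{K_v}` on which `κ` is non-trivial -/

section Existence

variable {K : Type u} [Field K] [NumberField K] {M : Type u} [AddCommGroup M] [TopologicalSpace M]
  [DiscreteTopology M] [Finite M] (ρ : DiscreteGaloisModule K M) {p : ℕ} [Fact p.Prime]
  (κ : ZpExtension K p) (v : HeightOneSpectrum (𝓞 K))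

/-- **The auxiliary element exists as soon as `κ` is non-trivial on `Γ_{K_v}`** (i.e. `v` is not
split completely in `K_∞/K`; automatic for the cyclotomic `ℤ_p`-extension of `ℚ`, where every
finite prime is finitely decomposed).  Given `τ ∈ Γ_{K_v}` with `κ(res τ) ≠ 1`, the power
`g = τ^{N₁N₂}` — `N₁` the order of `ρ(res τ)` in the finite group `Aut(M)`, `N₂` the order of `τ` on
the finite set `μ_p(K̄_v)` — acts trivially on `M` and on `μ_p`, and `κ(res g) = κ(res τ)^{N₁N₂} ≠ 1`
(`ℤ_p` is torsion-free), so `g` has a finite depth `m` (the `p`-adic valuation of `κ(res g)`): the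
hypotheses of §§1–4.  (Over `ℚ` with `τ` of minimal depth `s_v` one gets `m = s_v + v_p(N₁N₂)`.)
[cite: Washington1997, §13.1–§13.2] -/
theorem exists_trivial_depth_of_apply_ne_one (τ : absoluteGaloisGroup (v.adicCompletion K))
    (hτ : κ (absGaloisRestrict K (v.adicCompletion K) τ) ≠ 1) :
    ∃ (g : absoluteGaloisGroup (v.adicCompletion K)) (m : ℕ),
      ρ (absGaloisRestrict K (v.adicCompletion K) g) = 1 ∧
      (∀ ζ : (AlgebraicClosure (v.adicCompletion K))ˣ, ζ ^ p = 1 → g • ζ = ζ) ∧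
      absGaloisRestrict K (v.adicCompletion K) g ∈ κ.layerSubgroup m ∧
      absGaloisRestrict K (v.adicCompletion K) g ∉ κ.layerSubgroup (m + 1) := by
  set F := v.adicCompletion K
  haveI : NeZero p := ⟨(Fact.out : p.Prime).ne_zero⟩
  -- `N₁`: the order of `ρ(res τ)` in the finite group of units of `End(M)`
  haveI : Finite (M →ₗ[ℤ] M) := Finite.of_injective (fun f => (f : M → M)) DFunLike.coe_injective
  haveI : Finite (M →ₗ[ℤ] M)ˣ := Finite.of_injective _ Units.val_injective
  set u₁ := Representation.asGroupHom ρ.toRepresentation (absGaloisRestrict K F τ) with hu₁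
  set N₁ := orderOf u₁ with hN₁
  have hN₁pos : 0 < N₁ := orderOf_pos u₁
  have h1 : ρ (absGaloisRestrict K F τ) ^ N₁ = 1 := by
    have h := congrArg (fun w : (M →ₗ[ℤ] M)ˣ => (w : M →ₗ[ℤ] M)) (pow_orderOf_eq_one u₁)
    simp only [Units.val_pow_eq_pow_val, Units.val_one] at h
    exact h
  -- `N₂`: the order of `τ` acting on the finite set `μ_p(F̄)`
  haveI : Finite (rootsOfUnity p (AlgebraicClosure F)) := inferInstance
  set u₂ := MulAction.toPermHom (absoluteGaloisGroup F) (rootsOfUnity p (AlgebraicClosure F)) τ with hu₂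
  set N₂ := orderOf u₂ with hN₂
  have hN₂pos : 0 < N₂ := orderOf_pos u₂
  have h2 : ∀ ζ : rootsOfUnity p (AlgebraicClosure F), (τ ^ N₂) • ζ = ζ := fun ζ => by
    have h := pow_orderOf_eq_one u₂
    rw [← hN₂, hu₂, ← map_pow] at h
    have h' := Equiv.congr_fun h ζ
    simpa only [MulAction.toPermHom_apply, MulAction.toPerm_apply, Equiv.Perm.coe_one, id_eq] using h'
  -- the element
  refine ⟨τ ^ (N₁ * N₂), PadicInt.valuation ((κ (absGaloisRestrict K F (τ ^ (N₁ * N₂)))).toAdd),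
    ?_, ?_, ?_, ?_⟩
  · rw [map_pow, map_pow, pow_mul, h1, one_pow]
  · intro ζ hζ
    have hmem : ζ ∈ rootsOfUnity p (AlgebraicClosure F) := (mem_rootsOfUnity _ _).2 hζ
    have h := h2 ⟨ζ, hmem⟩
    have h' : (τ ^ (N₁ * N₂)) • (⟨ζ, hmem⟩ : rootsOfUnity p (AlgebraicClosure F)) = ⟨ζ, hmem⟩ := by
      rw [mul_comm, pow_mul]
      -- `(τ^{N₂})^{N₁}` acts trivially since `τ^{N₂}` does
      induction N₁ with
      | zero => rw [pow_zero, one_smul]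
      | succ n ih => rw [pow_succ, mul_smul, h, ih]
    have := congrArg (fun z : rootsOfUnity p (AlgebraicClosure F) => (z : (AlgebraicClosure F)ˣ)) h'
    simpa only [absoluteGaloisGroup.coe_smul_rootsOfUnity] using this
  · -- `p^m ∣ κ(res g)` with `m` the valuation
    have hx : (κ (absGaloisRestrict K F (τ ^ (N₁ * N₂)))).toAdd ≠ 0 := by
      rw [map_pow, map_pow, toAdd_pow, nsmul_eq_mul]
      refine mul_ne_zero (Nat.cast_ne_zero.2 (Nat.mul_pos hN₁pos hN₂pos).ne') fun h => hτ ?_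
      rw [← ofAdd_toAdd (κ _), h, ofAdd_zero]
    rw [ZpExtension.mem_layerSubgroup, ← Ideal.mem_span_singleton,
      PadicInt.mem_span_pow_iff_le_valuation _ hx]
  · have hx : (κ (absGaloisRestrict K F (τ ^ (N₁ * N₂)))).toAdd ≠ 0 := by
      rw [map_pow, map_pow, toAdd_pow, nsmul_eq_mul]
      refine mul_ne_zero (Nat.cast_ne_zero.2 (Nat.mul_pos hN₁pos hN₂pos).ne') fun h => hτ ?_
      rw [← ofAdd_toAdd (κ _), h, ofAdd_zero]
    rw [ZpExtension.mem_layerSubgroup, ← Ideal.mem_span_singleton,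
      PadicInt.mem_span_pow_iff_le_valuation _ hx]
    omega

end Existence

/-! ## §6 Packaging for the G1 map: a uniform exponent `ε_v`, for all levels `J` at once -/

section Uniform

variable {K : Type u} [Field K] [NumberField K] {M : Type u} [AddCommGroup M] [TopologicalSpace M]
  [DiscreteTopology M] [Finite M] (ρ : DiscreteGaloisModule K M) {p : ℕ} [Fact p.Prime]
  (hM : ∀ x : M, p • x = 0) (κ : ZpExtension K p) (v : HeightOneSpectrum (𝓞 K))

/-- **Uniform local exponent, existential form.**  At a finite place `v ∤ p` at which `κ` is
non-trivial (witness: any `τ ∈ Γ_{K_v}` with `κ(res τ) ≠ 1`) there is ONE exponent `ε_v` such that for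
EVERY level `J`, every `ε ≥ ε_v` and every class `c ∈ H¹(K_v, 𝒯_J)`: `T_v^[ε] c = 0`.  (Take `ε_v =
2d·p^m` of `localShift_iterate_eq_zero_of_depth` for the element of `exists_trivial_depth_of_apply_ne_one`,
`#M = p^d`.)  With `ε(E, p, S) := max_{v ∈ S ∖ {p}} ε_v` this is the uniform exponent of the G1 design
note of crux 19276. [cite: MilneADT2006, Ch. I §2, Thm. 2.8 (p. 31)] [cite: Washington1997, §13.1–§13.2] -/
theorem exists_uniform_localShift_iterate_eq_zero (hpv : (p : 𝓞 K) ∉ v.asIdeal)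
    (τ : absoluteGaloisGroup (v.adicCompletion K))
    (hτ : κ (absGaloisRestrict K (v.adicCompletion K) τ) ≠ 1) :
    ∃ εv : ℕ, ∀ ⦃ε : ℕ⦄, εv ≤ ε → ∀ (J : ℕ)
      (c : galoisCohomology (GaloisRep.toLocal v (κ.twistModP ρ hM J)) 1),
      (galoisCohomology.map ((κ.twistModPShift ρ hM J).restrictField (v.adicCompletion K)) 1)^[ε] c = 0 := by
  obtain ⟨d, hd⟩ := exists_card_eq_prime_pow M (fun x => ⟨1, by rw [pow_one]; exact hM x⟩)
  obtain ⟨g, m, hg, hμ, hgm, hgm'⟩ := exists_trivial_depth_of_apply_ne_one ρ κ v τ hτ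
  refine ⟨2 * d * p ^ m, fun ε hε J c => ?_⟩
  obtain ⟨r, rfl⟩ := Nat.exists_eq_add_of_le hε
  rw [Function.iterate_add_apply]
  exact localShift_iterate_eq_zero_of_depth ρ hM κ J v hpv hd hg hμ hgm hgm' _

/-- **Uniform local exponent, global form** (the shape "`T^[ε] · loc_v ψ = 0` for `v ∈ S ∖ {p}`,
uniformly in `J`" of the G1 map of crux 19276): at a finite place `v ∤ p` with `κ|_{Γ_{K_v}} ≠ 1` there
is `ε_v` such that for every level `J`, every `ε ≥ ε_v` and every GLOBAL class `y ∈ H¹(K, 𝒯_J)`,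
`loc_v (T^[ε] y) = 0` (k6-ty's `shiftH1`, `galoisCohomology.localization`).
[cite: MilneADT2006, Ch. I §2, Thm. 2.8 (p. 31)] [cite: SerreGaloisCohomology1997, I §2.4] -/
theorem exists_uniform_localization_shiftH1_iterate_eq_zero (hpv : (p : 𝓞 K) ∉ v.asIdeal)
    (τ : absoluteGaloisGroup (v.adicCompletion K))
    (hτ : κ (absGaloisRestrict K (v.adicCompletion K) τ) ≠ 1) :
    ∃ εv : ℕ, ∀ ⦃ε : ℕ⦄, εv ≤ ε → ∀ (J : ℕ) (y : galoisCohomology (κ.twistModP ρ hM J) 1),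
      galoisCohomology.localization (κ.twistModP ρ hM J) (Sum.inr v) 1 ((κ.shiftH1 ρ hM J)^[ε] y) = 0 := by
  obtain ⟨d, hd⟩ := exists_card_eq_prime_pow M (fun x => ⟨1, by rw [pow_one]; exact hM x⟩)
  obtain ⟨g, m, hg, hμ, hgm, hgm'⟩ := exists_trivial_depth_of_apply_ne_one ρ κ v τ hτ
  refine ⟨2 * d * p ^ m, fun ε hε J y => ?_⟩
  obtain ⟨r, rfl⟩ := Nat.exists_eq_add_of_le hε
  rw [Function.iterate_add_apply]
  exact localization_shiftH1_iterate_eq_zero_of_depth ρ hM κ J v hpv hd hg hμ hgm hgm' _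

end Uniform

/-! ## §7 The cyclotomic `ℤ_p`-extension: `κ` is non-trivial on EVERY decomposition group, so the
uniform exponent exists at every `v ∤ p` — and uniformly on any finite set of such places -/

section Cyclotomic

variable {K : Type} [Field K] [NumberField K] {M : Type} [AddCommGroup M] [TopologicalSpace M]
  [DiscreteTopology M] [Finite M] (ρ : DiscreteGaloisModule K M) {p : ℕ} [Fact p.Prime]
  (hM : ∀ x : M, p • x = 0) (κ : ZpExtension K p)

/-- **Cyclotomic case, one place.**  For the CYCLOTOMIC `ℤ_p`-extension of a number field no finite
place splits completely (tree `exists_apply_resGal_ne_one_of_isCyclotomic'`, Greenberg LNM 1716 §1 /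
Washington §13.1), so at every `v ∤ p` there is `ε_v` with `loc_v (T^[ε] y) = 0` for all `ε ≥ ε_v`,
all levels `J` and all global `y ∈ H¹(K, 𝒯_J)`. [cite: GreenbergLNM1716, §1] [cite: Washington1997, §13.1] -/
theorem exists_uniform_localization_shiftH1_iterate_eq_zero_of_isCyclotomic (hκ : κ.IsCyclotomic)
    (v : HeightOneSpectrum (𝓞 K)) (hpv : (p : 𝓞 K) ∉ v.asIdeal) :
    ∃ εv : ℕ, ∀ ⦃ε : ℕ⦄, εv ≤ ε → ∀ (J : ℕ) (y : galoisCohomology (κ.twistModP ρ hM J) 1),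
      galoisCohomology.localization (κ.twistModP ρ hM J) (Sum.inr v) 1 ((κ.shiftH1 ρ hM J)^[ε] y) = 0 := by
  obtain ⟨τ, hτ⟩ := exists_apply_resGal_ne_one_of_isCyclotomic' K p hκ v
  exact exists_uniform_localization_shiftH1_iterate_eq_zero ρ hM κ v hpv τ hτ

/-- **Cyclotomic case, a finite set of places away from `p` (the shape of the G1 stub of crux 19276:
ONE `ε` for all `v ∈ S ∖ {p}` and all `J`).**  For `κ` cyclotomic and a finite set `S` of places
`v ∤ p` there is `ε` such that `loc_v (T^[ε'] y) = 0` for every `v ∈ S`, every `ε' ≥ ε`, every level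
`J` and every global class `y ∈ H¹(K, 𝒯_J)` (`ε := max_{v ∈ S} ε_v`).
[cite: GreenbergLNM1716, §1] [cite: MilneADT2006, Ch. I §2, Thm. 2.8 (p. 31)] -/
theorem exists_uniform_localization_shiftH1_iterate_eq_zero_finset_of_isCyclotomic
    (hκ : κ.IsCyclotomic) (S : Finset (HeightOneSpectrum (𝓞 K)))
    (hS : ∀ v ∈ S, (p : 𝓞 K) ∉ v.asIdeal) :
    ∃ ε : ℕ, ∀ ⦃ε' : ℕ⦄, ε ≤ ε' → ∀ v ∈ S, ∀ (J : ℕ) (y : galoisCohomology (κ.twistModP ρ hM J) 1),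
      galoisCohomology.localization (κ.twistModP ρ hM J) (Sum.inr v) 1 ((κ.shiftH1 ρ hM J)^[ε'] y)
        = 0 := by
  classical
  -- a bound `f v` at each `v ∈ S` (and `0` elsewhere), then `ε := S.sup f`
  have hch : ∀ v : HeightOneSpectrum (𝓞 K), ∃ εv : ℕ, v ∈ S → ∀ ⦃ε : ℕ⦄, εv ≤ ε →
      ∀ (J : ℕ) (y : galoisCohomology (κ.twistModP ρ hM J) 1),
        galoisCohomology.localization (κ.twistModP ρ hM J) (Sum.inr v) 1 ((κ.shiftH1 ρ hM J)^[ε] y)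
          = 0 := by
    intro v
    by_cases hv : v ∈ S
    · obtain ⟨εv, h⟩ :=
        exists_uniform_localization_shiftH1_iterate_eq_zero_of_isCyclotomic ρ hM κ hκ v (hS v hv)
      exact ⟨εv, fun _ => h⟩
    · exact ⟨0, fun h => absurd h hv⟩
  choose f hf using hch
  refine ⟨S.sup f, fun ε' hε' v hv J y => hf v hv ((Finset.le_sup hv).trans hε') J y⟩

end Cyclotomic

end Summit.BirchSwinnertonDyer.BirchSwinnertonDyer.Rank1Residual.LocalSplitPrime

end
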